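import Literature.NumberTheory.Transcendental.KZSemiCanonicalReductionProofs
import Summits.KontsevichZagierPeriods.KontsevichZagierPeriods.Theses.ScissorsTransport

/-!
# Route ScissorsTransport — support item `CylinderReduction` (stmt-KontsevichZagierPeriods-10816)

The move bookkeeping that turns a stabilised representation back into a KZ-equivalence: for an
integrand-`1` representation `r = [σ, 1]` of dimension `N` and an integrand-`1` representation `s`
of dimension `N + M` whose domain is a full-measure subset of the cylinder
`cyl σ = {z | (fun i => z (Fin.castAdd M i)) ∈ σ ∧ ∀ j, z (Fin.natAdd N j) ∈ [0, 1]} = σ × [0,1]^M`,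
the representations `r` and `s` are KZ-equivalent (`KZ.Equivalent r s`, i.e.
`[r] − [s] ∈ KZ.relations`).

Proof (the fixed calculus of `KZCalculus.lean` only):

* the `M`-fold iterate `R_M` of the slab move at level `0` (`R₀ = r`, `R_{k+1} = R_k.slab 0`,
  `KZ.IntegralRep.slab` of `KZCalculusProofs.lean`) is equivalent to `r` (each slab is ONE
  Newton–Leibniz move, `KZ.IntegralRep.equivalent_slab`), has integrand `r.integrand ∘ proj`, and
  its domain is EXACTLY the cylinder `cyl σ` — the two `Fin` identities
  `Fin.castSucc (Fin.castAdd k i) = Fin.castAdd (k + 1) i` and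
  `Fin.last (N + k) = Fin.natAdd N (Fin.last k)` (`exists_equivalent_domain_eq_cylinder`);
* null removal: `[R_M] − [s] ∈ relations` by `KZ.of_sub_of_mem_relations_of_null`
  (`s.domain ⊆ cyl σ`, `vol (cyl σ ∖ s.domain) = 0`, both integrands are `1` on the overlap);
* compose by transitivity of `KZ.Equivalent`.

The route file `Theses/ScissorsTransport.lean` (rev 3) does not (yet) declare `CylinderReduction`
(gate TODO line), so the closing theorem `CylinderReduction_proof` is stated with the item's
ledger signature verbatim.

Sources: M. Kontsevich, D. Zagier, *Periods* (2001), §1.2, rules (1) and (3);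
J. Viu-Sos, Int. J. Number Theory 17 (2021), Thm. 1.1 (volumes of semialgebraic sets as the normal
form). Deliberately NOT here: the converse bookkeeping `StableSetTransport → VolumeForm` (ten lines
over this item, filed with the frame item `VolumeForm`).
-/

namespace Summit.KontsevichZagierPeriods.ScissorsTransport

open Set MeasureTheory
open Literature.NumberTheory.Transcendental Literature.NumberTheory.Transcendental.KZ

/-- **Iterated slabs realise the cylinder.** For every representation `r` of dimension `N` and
every `M` there is a representation `R` of dimension `N + M` whose domain is exactly the cylinder
`{z | (fun i => z (Fin.castAdd M i)) ∈ r.domain ∧ ∀ j, z (Fin.natAdd N j) ∈ [0, 1]}`, whose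
integrand is `z ↦ r.integrand (fun i => z (Fin.castAdd M i))`, and which is KZ-equivalent to `r`:
the `M`-fold iterate of the slab move at level `0` (`KZ.IntegralRep.slab`, one Newton–Leibniz move
each, `KZ.IntegralRep.equivalent_slab`). [Kontsevich–Zagier 2001, §1.2, rule (3)] -/
theorem exists_equivalent_domain_eq_cylinder {N : ℕ} (r : IntegralRep N) :
    ∀ M : ℕ, ∃ R : IntegralRep (N + M),
      R.domain = {z | (fun i : Fin N => z (Fin.castAdd M i)) ∈ r.domain ∧
        ∀ j : Fin M, z (Fin.natAdd N j) ∈ Set.Icc (0:ℝ) 1} ∧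
      (∀ z, R.integrand z = r.integrand (fun i : Fin N => z (Fin.castAdd M i))) ∧
      Equivalent r R
  | 0 => by
    refine ⟨r, ?_, ?_, Equivalent.refl r⟩
    · ext z
      simp only [mem_setOf_eq, IsEmpty.forall_iff, and_true]
      exact Iff.of_eq (congrArg (· ∈ r.domain) (funext fun i => rfl))
    · intro z
      rfl
  | M + 1 => by
    obtain ⟨R, hdom, hint, hequiv⟩ := exists_equivalent_domain_eq_cylinder r M
    refine ⟨R.slab 0, ?_, ?_, hequiv.trans (R.equivalent_slab 0)⟩
    · ext z
      simp only [IntegralRep.domain_slab, IntegralRep.slabDomain, hdom, mem_setOf_eq,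
        Nat.cast_zero, zero_add, Fin.forall_fin_succ', mem_Icc]
      constructor
      · rintro ⟨⟨h1, h2⟩, h3, h4⟩
        exact ⟨h1, fun j => h2 j, h3, h4⟩
      · rintro ⟨h1, h2, h3, h4⟩
        exact ⟨⟨h1, fun j => h2 j⟩, h3, h4⟩
    · intro z
      show R.integrand (Fin.init z) = _
      rw [hint]
      rfl

/-- **Cylinder reduction** (support item `CylinderReduction` of route ScissorsTransport,
stmt-KontsevichZagierPeriods-10816, ledger signature verbatim): an integrand-`1` representation
`r` of dimension `N` is KZ-equivalent to every integrand-`1` representation `s` of dimension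
`N + M` whose domain is a full-measure subset of the cylinder `r.domain × [0,1]^M` (in the
`Fin.castAdd` / `Fin.natAdd` coordinates). Proof: `M` slab moves
(`exists_equivalent_domain_eq_cylinder`) and one null removal
(`KZ.of_sub_of_mem_relations_of_null`). [Kontsevich–Zagier 2001, §1.2, rules (1), (3)] -/
theorem CylinderReduction_proof :
    ∀ ⦃N M : ℕ⦄ (r : Literature.NumberTheory.Transcendental.KZ.IntegralRep N)
      (s : Literature.NumberTheory.Transcendental.KZ.IntegralRep (N + M)),
      (∀ x ∈ r.domain, r.integrand x = 1) →
      s.domain ⊆ {z | (fun i : Fin N => z (Fin.castAdd M i)) ∈ r.domain ∧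
        ∀ j : Fin M, z (Fin.natAdd N j) ∈ Set.Icc (0:ℝ) 1} →
      MeasureTheory.volume ({z : Fin (N + M) → ℝ | (fun i : Fin N => z (Fin.castAdd M i)) ∈
        r.domain ∧ ∀ j : Fin M, z (Fin.natAdd N j) ∈ Set.Icc (0:ℝ) 1} \ s.domain) = 0 →
      (∀ z ∈ s.domain, s.integrand z = 1) →
      Literature.NumberTheory.Transcendental.KZ.Equivalent r s := by
  intro N M r s hr hsub hnull hs
  obtain ⟨R, hdom, hint, hequiv⟩ := exists_equivalent_domain_eq_cylinder r M
  refine hequiv.trans ?_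
  show of R - of s ∈ relations
  refine of_sub_of_mem_relations_of_null R s ?_ ?_ ?_
  · rwa [hdom]
  · rw [hdom, Set.sdiff_eq_empty.mpr hsub, measure_empty]
  · intro z hz
    rw [hint, hr _ (hdom ▸ hz.1).1, hs z hz.2]

end Summit.KontsevichZagierPeriods.ScissorsTransport
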